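import Literature.Topology.FourManifolds.SurfaceGroupNielsenCoreCaseSameKernel
import Literature.Topology.FourManifolds.SurfaceGroupNielsenCoreCaseJJ
import Literature.Topology.FourManifolds.SurfaceGroupNielsenCoreCasePPSame
import Literature.Topology.FourManifolds.SurfaceGroupNielsenCoreCasePPii
import Literature.Topology.FourManifolds.SurfaceGroupNielsenCoreCasePPio
import Literature.Topology.FourManifolds.SurfaceGroupNielsenCoreCasePPoi
import Literature.Topology.FourManifolds.SurfaceGroupNielsenCoreCasePPoo
import Literature.Topology.FourManifolds.SurfaceGroupNielsenCoreCasePJ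
import Literature.Topology.FourManifolds.SurfaceGroupNielsenCoreCasePJOut
import Literature.Topology.FourManifolds.SurfaceGroupNielsenCoreCaseJP
import Literature.Topology.FourManifolds.SurfaceGroupRelatorEndIsAut
import HarnessLib

/-!
# Nielsen's theorem for closed orientable surface groups (CORE dispatcher and the named fact)

Topic `Literature/Topology/FourManifolds`.  `noDoublePoints_holds`: no potential-minimal
configuration of a relator-killing, indecomposable, marked non-trivial assignment has a double
point — by dispatch over the cut types of the two positions `a < b` of the double point
(junction / portal; for portals, the position of the partner occurrence; the same-symbol and
same-kernel cases), each case being a separate theorem of the files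
`SurfaceGroupNielsenCoreCase*.lean` (Zieschang–Vogt–Coldewey, LNM 835, proof of Thm. 5.3.2 with
Lemma 5.3.4, in minimal-counterexample form: per-level parity of the crossing edges of the partner
graph).  Hence `NoDoublePointK g` for `g ≥ 2` and, with the four landed pillars (block lemma A3,
planar counting B, degree C1, Zieschang–Nielsen C2: `nielsen_of_noDoublePoints_of_relatorEndIsAut`,
`relatorEndIsAut_holds`) and genus `≤ 1` (`nielsen_surfaceGroup_mulEquiv_lift_of_le_one`),
**Nielsen's theorem** — the named fact `nielsen_surfaceGroup_mulEquiv_lift` of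
`TrisectionFunctorGKStabilizationSplit.lean` holds (`nielsen_surfaceGroup_mulEquiv_lift_holds`):
every automorphism of `S_g = ⟨a₁, b₁, …, a_g, b_g ∣ ∏ [aᵢ, bᵢ]⟩` lifts to an automorphism of the
free group carrying the relator to a conjugate of itself or of its inverse.

## References

* J. Nielsen, *Untersuchungen zur Topologie der geschlossenen zweiseitigen Flächen I*, Acta Math.
  50 (1927) 189–358. [Nielsen1927]
* H. Zieschang, E. Vogt, H.-D. Coldewey, *Surfaces and Planar Discontinuous Groups*, LNM 835
  (1980), Thm. 5.3.2, Lemma 5.3.4, Cor. 5.3.5, Thm. 5.6.1. [ZieschangVogtColdewey1980]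
-/

noncomputable section

namespace Literature.Topology.FourManifolds

open Literature.GroupTheory.CombinatorialGroupTheory List

namespace SurfaceGroup

/-! ## The dispatcher -/

/-- **No potential-minimal configuration has a double point** (`g ≥ 2`).
[cite: ZieschangVogtColdewey1980, Thm. 5.3.2 and Cor. 5.3.5] -/
theorem noDoublePoints_holds (g : ℕ) (hg : 2 ≤ g) : NoDoublePoints g := by
  intro φ _hK hI hM κ hmin d
  have hab := d.lt
  have hbℓ := d.lt_length
  have haℓ : d.a < (CycFactors.closedPath κ.U).length := hab.trans hbℓ
  -- same kernel?
  by_cases hsk : ∃ k, κ.PortalAt d.a k ∧ κ.PortalAt d.b k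
  · obtain ⟨k, hPa, hPb⟩ := hsk
    exact Config.false_of_doublePoint_sameKernel hg hI hM κ hmin d hPa hPb
  have hsep : ∀ j, ¬ (κ.PortalAt d.a j ∧ κ.PortalAt d.b j) := fun j hj => hsk ⟨j, hj⟩
  rcases κ.isJunction_or_portalAt haℓ with hJa | ⟨k, hk, hPa⟩
  · rcases κ.isJunction_or_portalAt hbℓ with hJb | ⟨k', hk', hPb⟩
    · exact Config.false_of_doublePoint_JJ hg hI hM κ hmin d hJa hJb
    · -- J-P: the partner of `k'` is not a portal
      have hna : ¬ κ.PortalAt d.a (κ.bar k') := κ.not_portalAt_of_isJunction hJa _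
      have hnb : ¬ κ.PortalAt d.b (κ.bar k') := κ.not_portalAt_bar hk' hPb
      rcases κ.inside_or_outside hna hnb with hin | hout
      · exact Config.false_of_doublePoint_JP_inside hg hI hM κ hmin d hJa hPb hin
      · exact Config.false_of_doublePoint_JP_outside hg hI hM κ hmin d hJa hPb hout
  · rcases κ.isJunction_or_portalAt hbℓ with hJb | ⟨k', hk', hPb⟩
    · -- P-J
      have hna : ¬ κ.PortalAt d.a (κ.bar k) := κ.not_portalAt_bar hk hPa
      have hnb : ¬ κ.PortalAt d.b (κ.bar k) := κ.not_portalAt_of_isJunction hJb _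
      rcases κ.inside_or_outside hna hnb with hin | hout
      · exact Config.false_of_doublePoint_PJ_inside hg hI hM κ hmin d hPa hJb hin
      · exact Config.false_of_doublePoint_PJ_outside hg hI hM κ hmin d hPa hJb hout
    · -- P-P
      by_cases hsame : k' = κ.bar k
      · subst hsame
        exact Config.false_of_doublePoint_PP_same hg hI hM κ hmin d hPa hPb
      · -- partners are non-portal
        have hna : ¬ κ.PortalAt d.a (κ.bar k) := κ.not_portalAt_bar hk hPa
        have hnb : ¬ κ.PortalAt d.b (κ.bar k) := fun h => hsame (κ.portalAt_unique hPb h)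
        have hna' : ¬ κ.PortalAt d.a (κ.bar k') := by
          intro h
          have := κ.portalAt_unique hPa h
          -- `k = bar k'` ⇒ `k' = bar k`
          exact hsame (by rw [this, κ.bar_bar hk'])
        have hnb' : ¬ κ.PortalAt d.b (κ.bar k') := κ.not_portalAt_bar hk' hPb
        rcases κ.inside_or_outside hna hnb with hki | hko <;>
          rcases κ.inside_or_outside hna' hnb' with hk'i | hk'o
        · exact Config.false_of_doublePoint_PP_ii hg hI hM κ hmin d hPa hPb hsame hki hk'i
        · exact Config.false_of_doublePoint_PP_io hg hI hM κ hmin d hPa hPb hsame hki hk'o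
        · exact Config.false_of_doublePoint_PP_oi hg hI hM κ hmin d hPa hPb hsame hko hk'i
        · exact Config.false_of_doublePoint_PP_oo hg hI hM κ hmin d hPa hPb hsame
            (fun h => hsep k ⟨hPa, h ▸ hPb⟩) hko hk'o

/-- **`NoDoublePointK g` for `g ≥ 2`.** [cite: ZieschangVogtColdewey1980, Thm. 5.3.2 and Cor. 5.3.5] -/
theorem noDoublePointK_holds (g : ℕ) (hg : 2 ≤ g) : NoDoublePointK g :=
  noDoublePointK_of_noDoublePoints (by omega) (noDoublePoints_holds g hg)

/-- **The CORE pillar** `HomotopicSimpleK g` for `g ≥ 2` (ZVC Thm. 5.2.6 with Thm. 5.3.2 and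
Cor. 5.3.5). [cite: ZieschangVogtColdewey1980, Thm. 5.3.2 and Cor. 5.3.5] -/
theorem homotopicSimpleK_holds (g : ℕ) (hg : 2 ≤ g) : HomotopicSimpleK g :=
  homotopicSimpleK_of_noDoublePointK (noDoublePointK_holds g hg)

end SurfaceGroup

/-- **Nielsen's theorem** (the named fact `nielsen_surfaceGroup_mulEquiv_lift` holds): every
automorphism of the surface group `S_g` lifts to an automorphism of the free group on the `2g`
generators carrying the relator to a conjugate of itself or of its inverse.
[cite: Nielsen1927] [cite: ZieschangVogtColdewey1980, Thm. 5.6.1] -/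
theorem nielsen_surfaceGroup_mulEquiv_lift_holds : nielsen_surfaceGroup_mulEquiv_lift :=
  SurfaceGroup.nielsen_of_noDoublePoints_of_relatorEndIsAut SurfaceGroup.noDoublePoints_holds
    fun g _ => SurfaceGroup.relatorEndIsAut_holds g

end Literature.Topology.FourManifolds

end
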